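import Summits.SmoothPoincare4.SmoothPoincare4.Theorems.ConvexBisectionAcyclicBisectionExistsHgapTwistRows
import Summits.SmoothPoincare4.SmoothPoincare4.Theorems.ConvexBisectionAcyclicBisectionExistsOrseamPageDet
import HarnessLib

/-!
# Hgap ▸ part B, transfer step (R6c), tube side II: the orientation character of the attaching tube
# at the core is the frame sign `ε`
(wave 7, crux stmt-SmoothPoincare4-10508, line `modp-braid-orbits`, stub `stub_T3_dualPresentation` (T3)
▸ HB = `helper_Hgap_twisting` ▸ (R6c); registered sub-goal `helper_attachChar_core`)

The tube-side map of the transfer `σ̂ = -s₀ ε` (`G2-REPORT.md` §4 (R6b), (R6c)) is `η̂ = f♭ ∘ flip` with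
`f♭ = (h j).boundaryTube` the ATTACHING tube.  This file studies the attaching tube as a map of three
real variables `q = (m'₀, m'₁, ψ)`,

  `F (q) := ((f♭ (e^{2πiψ}, (m'₀, m'₁))).1).1 = (f (depthLine (circlePt ψ) m' 0)).1 ∈ ℝ⁴`,

whose columns at a core point `q₀ = (0, 0, t)` are `(D e₀, D e₁, K'(t))`, `D` the fibre derivative of the
attaching tube `v ↦ (f (depthLine (e^{2πit}) v 0)).1` at `0` (companion file `…HgapCharTubeChart.lean`).  Here:

* §1 the orientation function of a pair of tubes is the determinant of the fibre derivative up to a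
  positive factor (`frameSign_eq_det_div`), so a sign `ε` of `frameSign` is a sign of `det A`
  (`fibreDeriv_det_sign`) and `det A ≠ 0` (`fibreDeriv_det_ne_zero`);
* §2 **the orientation character at the core** (`det4_fibreDeriv_core`): through Z4's page tube `Φ`
  (fibre frame `(r iK', κ rot)`, transition matrix `A = CircleTube.fibreDeriv f♭ Φ`),
  `det4 (∇rho (K t), D e₀, D e₁, K') = r κ det A(e^{2πit}) · γ · det4 (∇rho, K', iK', n)` with
  `γ = ⟪rot, n⟫ / ‖n‖² > 0` and `det4 (∇rho, K', iK', n) > 0` (X4 `det4_pageFrame_pos`), hence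
  **`0 < det A(e^{2πit}) · det4 (∇rho (K t), D e₀, D e₁, K')`** (`det4_fibreDeriv_core_pos`, registered as
  `helper_attachChar_core`): the orientation character of the attaching tube at the core is `ε`.

The sequel files transport this sign to nearby points (continuity) and through the polar flip
(`det D(flip) = -1`) to H1's tube-side character `χ_η`.  Everything is proved; no named facts, no `sorry`.
References: A. A. Kosinski, *Differential Manifolds* (1993), III (3.1), VI §6 [Kosinski1993];
R. İ. Baykur, AGT 6 (2006), §2.3 [Baykur2006].
-/

noncomputable section

set_option linter.dupNamespace false

open scoped Manifold ContDiff Topology RealInnerProductSpace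
open Set Function Metric Filter Complex

namespace Summit.SmoothPoincare4.SmoothPoincare4.Theorems.AcyclicBisectionExists.ModpBraidOrbits

open Literature.Topology.FourManifolds Literature.Topology.FourManifolds.LefschetzBase
  Literature.Topology.FourManifolds.HandleAttachingMap Literature.Geometry.Symplectic

variable {g : ℕ}

/-! ## §1 The orientation function of two tubes is the determinant of the fibre derivative -/

section FrameSign

variable {Y : Type*} [TopologicalSpace Y] [ChartedSpace (EuclideanSpace ℝ (Fin 3)) Y]

/-- **The orientation function is the determinant of the fibre derivative up to a positive factor**:
`frameSign Φ₁ Φ₂ x = ⟪A e₁, J (A e₀ / ‖A e₀‖)⟫ = det A / ‖A e₀‖`, `A = fibreDeriv Φ₁ Φ₂ x`. [folklore] -/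
theorem frameSign_eq_det_div (Φ₁ Φ₂ : CircleTube Y) (x : sphere (0 : EuclideanSpace ℝ (Fin 2)) 1) :
    CircleTube.frameSign Φ₁ Φ₂ x = ‖CircleTube.fibreDeriv Φ₁ Φ₂ x planeE0‖⁻¹ *
      ((CircleTube.fibreDeriv Φ₁ Φ₂ x planeE0) 0 * (CircleTube.fibreDeriv Φ₁ Φ₂ x planeE1) 1 -
        (CircleTube.fibreDeriv Φ₁ Φ₂ x planeE0) 1 * (CircleTube.fibreDeriv Φ₁ Φ₂ x planeE1) 0) := by
  unfold CircleTube.frameSign CircleTube.frameVec CircleTube.frameCol NormedSpace.normalize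
  set a := CircleTube.fibreDeriv Φ₁ Φ₂ x planeE0 with ha
  set b := CircleTube.fibreDeriv Φ₁ Φ₂ x planeE1 with hb
  rw [EuclideanSpace.inner_eq_star_dotProduct]
  simp [quarterTurn, dotProduct, Fin.sum_univ_two]
  ring

/-- For tubes with the same core the determinant of the fibre derivative does not vanish. [folklore] -/
theorem fibreDeriv_det_ne_zero {Φ₁ Φ₂ : CircleTube Y} (hcore : ∀ θ, Φ₁.core θ = Φ₂.core θ)
    (x : sphere (0 : EuclideanSpace ℝ (Fin 2)) 1) :
    (CircleTube.fibreDeriv Φ₁ Φ₂ x planeE0) 0 * (CircleTube.fibreDeriv Φ₁ Φ₂ x planeE1) 1 -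
      (CircleTube.fibreDeriv Φ₁ Φ₂ x planeE0) 1 * (CircleTube.fibreDeriv Φ₁ Φ₂ x planeE1) 0 ≠ 0 := by
  intro h0
  apply CircleTube.frameSign_ne_zero hcore x
  rw [frameSign_eq_det_div, h0, mul_zero]

/-- **A sign of the orientation function is a sign of the determinant**: `0 < ε · frameSign x` gives
`0 < ε · det A(x)`. [folklore] -/
theorem fibreDeriv_det_sign {Φ₁ Φ₂ : CircleTube Y} (hcore : ∀ θ, Φ₁.core θ = Φ₂.core θ) {ε : ℝ}
    (x : sphere (0 : EuclideanSpace ℝ (Fin 2)) 1) (hε : 0 < ε * CircleTube.frameSign Φ₁ Φ₂ x) :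
    0 < ε * ((CircleTube.fibreDeriv Φ₁ Φ₂ x planeE0) 0 * (CircleTube.fibreDeriv Φ₁ Φ₂ x planeE1) 1 -
      (CircleTube.fibreDeriv Φ₁ Φ₂ x planeE0) 1 * (CircleTube.fibreDeriv Φ₁ Φ₂ x planeE1) 0) := by
  rw [frameSign_eq_det_div, mul_left_comm] at hε
  have hpos : 0 < ‖CircleTube.fibreDeriv Φ₁ Φ₂ x planeE0‖⁻¹ :=
    inv_pos.2 (norm_pos_iff.2 (CircleTube.frameCol_ne_zero hcore x))
  exact pos_of_mul_pos_right hε hpos.le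

end FrameSign

/-! ## §2 The orientation character of the attaching tube at the core -/

section Core

variable (f : HandleAttachingMap 3 2 (Base g)) {c : ℂ} (hc : ‖c‖ = 1)
  (hKc : ∀ θ, f.attachingCircle θ ∈ page g c) {κ r : ℝ} {Φ : CircleTube (bBase g).carrier}
  (hΦcore : ∀ ψ, (bBase g).incl (Φ.core ψ) = f.attachingCircle ψ)
  (hΦder : ∀ t : ℝ, HasFDerivAt (fun v : EuclideanSpace ℝ (Fin 2) =>
      ((bBase g).incl (Φ.toHomeo (circlePt t, v))).1)
    ((EuclideanSpace.proj (𝕜 := ℝ) (0 : Fin 2)).smulRight (r • cplxJ (deriv (ambCurve g f.attachingCircle) t)) +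
      (EuclideanSpace.proj (𝕜 := ℝ) (1 : Fin 2)).smulRight (κ • rotField g (f.attachingCircle (circlePt t)).1)) 0)
include hc hKc hΦcore hΦder

/-- **The fibre columns and the velocity against `∇rho` at a core point, through a page tube.**  With Z4's
page tube `Φ` around the attaching circle `K ⊂ page g c` (fibre frame `(r iK', κ rot)`) and the transition
matrix `A = CircleTube.fibreDeriv f♭ Φ (e^{2πit})`:
`det4 (∇rho (K t), D e₀, D e₁, K'(t)) = r κ det A · (⟪rot, n⟫/‖n‖²) · det4 (∇rho (K t), K', iK', n)`,
`D` the fibre derivative of the attaching tube at the core point (`exists_fderiv_attachingFibre_eq`: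
`D m' = c K' + (A m')₀ r iK' + (A m')₁ κ rot`, then `rot = a K' + b iK' + γ n`, `γ = ⟪rot, n⟫/‖n‖²`, and the
recombination rule `det4_lincomb₃`). [cite: Kosinski1993, III (3.1)] -/
theorem det4_fibreDeriv_core (t : ℝ) :
    det4 (gradient (rho g) (ambCurve g f.attachingCircle t))
        (fderiv ℝ (fun v : EuclideanSpace ℝ (Fin 2) => (f.toFun (depthLine (circlePt t) v 0)).1) 0 planeE0)
        (fderiv ℝ (fun v : EuclideanSpace ℝ (Fin 2) => (f.toFun (depthLine (circlePt t) v 0)).1) 0 planeE1)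
        (deriv (ambCurve g f.attachingCircle) t) =
      r * κ * ((CircleTube.fibreDeriv f.boundaryTube Φ (circlePt t) planeE0) 0 *
          (CircleTube.fibreDeriv f.boundaryTube Φ (circlePt t) planeE1) 1 -
        (CircleTube.fibreDeriv f.boundaryTube Φ (circlePt t) planeE0) 1 *
          (CircleTube.fibreDeriv f.boundaryTube Φ (circlePt t) planeE1) 0) *
      (inner ℝ (rotField g (ambCurve g f.attachingCircle t)) (horizNormal g (ambCurve g f.attachingCircle t)) /
        inner ℝ (horizNormal g (ambCurve g f.attachingCircle t)) (horizNormal g (ambCurve g f.attachingCircle t))) *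
      det4 (gradient (rho g) (ambCurve g f.attachingCircle t)) (deriv (ambCurve g f.attachingCircle) t)
        (cplxJ (deriv (ambCurve g f.attachingCircle) t)) (horizNormal g (ambCurve g f.attachingCircle t)) := by
  have hcore : ∀ θ, f.boundaryTube.core θ = Φ.core θ := boundaryTube_core_eq_of_incl_core f hΦcore
  obtain ⟨c₀, hc₀⟩ := exists_fderiv_attachingFibre_eq f hcore t (hΦder t) planeE0
  obtain ⟨c₁, hc₁⟩ := exists_fderiv_attachingFibre_eq f hcore t (hΦder t) planeE1
  have hq : (f.attachingCircle (circlePt t)).1 = ambCurve g f.attachingCircle t := rfl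
  rw [hq] at hc₀ hc₁
  set a := CircleTube.fibreDeriv f.boundaryTube Φ (circlePt t) planeE0 with ha
  set b := CircleTube.fibreDeriv f.boundaryTube Φ (circlePt t) planeE1 with hb
  set q := ambCurve g f.attachingCircle t with hq_def
  set T := deriv (ambCurve g f.attachingCircle) t with hT_def
  set n := horizNormal g q with hn
  set R := rotField g q with hR_def
  -- page facts at the core point
  have hKd : MDifferentiableAt (𝓡 1) (𝓡∂ 4) f.attachingCircle (circlePt t) :=
    (isSmoothEmbedding_attachingCircle f).contMDiff.mdifferentiableAt (by simp)
  have hT : dPhiX g q * cx T + dPhiY q * cy T = 0 :=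
    dPhi_velocity_eq_zero_of_page hKc (hasDerivAt_ambCurve (g := g) hKd).differentiableAt.hasDerivAt
  have hw : w g q = c / 2 := (hKc (circlePt t)).2
  have hflat : ‖cx q‖ ^ 2 < 4 := (hKc (circlePt t)).1
  have hq0 : q ≠ 0 := ne_zero_of_w_eq_half hc hw
  have hw0 : w g q ≠ 0 := by
    rw [hw]; intro h0
    have : c = 0 := by linear_combination 2 * h0
    rw [this, norm_zero] at hc; exact zero_ne_one hc
  have hT0 : T ≠ 0 := deriv_ambCurve_ne_zero (isSmoothEmbedding_attachingCircle f) t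
  have hP : 0 < det4 (gradient (rho g) q) T (cplxJ T) n := det4_pageFrame_pos hq0 hflat hw0 hT0 hT
  -- tangency of the frame and of the rotation field
  have hgT : ⟪gradient (rho g) q, T⟫ = 0 := by
    rw [inner_gradient_eq_fderiv]; exact fderiv_rho_pageTangent hflat hT
  have hgU : ⟪gradient (rho g) q, cplxJ T⟫ = 0 := by
    rw [inner_gradient_eq_fderiv]; exact fderiv_rho_pageTangent hflat (dPhi_cplxJ_pageTangent hT)
  have hgn : ⟪gradient (rho g) q, n⟫ = 0 := by
    rw [inner_gradient_eq_fderiv]; exact fderiv_rho_horizNormal hq0 hflat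
  have hgR : ⟪gradient (rho g) q, R⟫ = 0 := by
    rw [inner_gradient_eq_fderiv]; exact fderiv_rho_rotField q
  obtain ⟨a', b', γ, hR⟩ := exists_coeffs_of_tangent hP.ne' hgT hgU hgn hgR
  -- `γ = ⟪rot, n⟫ / ⟪n, n⟫`
  have hTn : ⟪T, n⟫ = 0 := by
    rw [hn, inner_horizNormal, hT, mul_zero, Complex.zero_im, zero_div]
  have hUn : ⟪cplxJ T, n⟫ = 0 := inner_cplxJ_horizNormal_eq_zero hT
  have hnn : ⟪n, n⟫ ≠ 0 := by
    rw [real_inner_self_eq_norm_sq]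
    intro h0
    have h1 := norm_horizNormal_sq_of_page (g := g) hc hw
    rw [← hn, h0, zero_mul] at h1
    exact zero_ne_one h1
  have hγ : γ = ⟪R, n⟫ / ⟪n, n⟫ := by
    have e : ⟪R, n⟫ = γ * ⟪n, n⟫ := by
      rw [hR, inner_add_left, inner_add_left, real_inner_smul_left, real_inner_smul_left,
        real_inner_smul_left, hTn, hUn, mul_zero, mul_zero, zero_add, zero_add]
    rw [e]; field_simp
  -- the two fibre columns in the frame `(T, iT, n)`
  have e0 : fderiv ℝ (fun v : EuclideanSpace ℝ (Fin 2) => (f.toFun (depthLine (circlePt t) v 0)).1) 0 planeE0 =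
      (c₀ + κ * a 1 * a') • T + (r * a 0 + κ * a 1 * b') • cplxJ T + (κ * a 1 * γ) • n := by
    rw [hc₀]
    show c₀ • T + (a 0 • (r • cplxJ T) + a 1 • (κ • R)) = _
    rw [hR]
    module
  have e1 : fderiv ℝ (fun v : EuclideanSpace ℝ (Fin 2) => (f.toFun (depthLine (circlePt t) v 0)).1) 0 planeE1 =
      (c₁ + κ * b 1 * a') • T + (r * b 0 + κ * b 1 * b') • cplxJ T + (κ * b 1 * γ) • n := by
    rw [hc₁]
    show c₁ • T + (b 0 • (r • cplxJ T) + b 1 • (κ • R)) = _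
    rw [hR]
    module
  have eT : (1 : ℝ) • T + (0 : ℝ) • cplxJ T + (0 : ℝ) • n = T := by simp
  have key := det4_lincomb₃ (gradient (rho g) q) T (cplxJ T) n
    (c₀ + κ * a 1 * a') (r * a 0 + κ * a 1 * b') (κ * a 1 * γ)
    (c₁ + κ * b 1 * a') (r * b 0 + κ * b 1 * b') (κ * b 1 * γ) 1 0 0
  rw [eT] at key
  rw [e0, e1, key, hγ]
  ring

/-- **The orientation character of the attaching tube at a core point has the sign of `det A`** (`= ε`, the
frame sign): for `0 < r`, `0 < κ`, `0 < det A(e^{2πit}) · det4 (∇rho (K t), D e₀, D e₁, K'(t))`. [cite: Baykur2006, §2.3] -/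
theorem det4_fibreDeriv_core_pos (hκ : 0 < κ) (hr : 0 < r) (t : ℝ) :
    0 < ((CircleTube.fibreDeriv f.boundaryTube Φ (circlePt t) planeE0) 0 *
          (CircleTube.fibreDeriv f.boundaryTube Φ (circlePt t) planeE1) 1 -
        (CircleTube.fibreDeriv f.boundaryTube Φ (circlePt t) planeE0) 1 *
          (CircleTube.fibreDeriv f.boundaryTube Φ (circlePt t) planeE1) 0) *
      det4 (gradient (rho g) (ambCurve g f.attachingCircle t))
        (fderiv ℝ (fun v : EuclideanSpace ℝ (Fin 2) => (f.toFun (depthLine (circlePt t) v 0)).1) 0 planeE0)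
        (fderiv ℝ (fun v : EuclideanSpace ℝ (Fin 2) => (f.toFun (depthLine (circlePt t) v 0)).1) 0 planeE1)
        (deriv (ambCurve g f.attachingCircle) t) := by
  rw [det4_fibreDeriv_core f hc hKc hΦcore hΦder t]
  have hcore : ∀ θ, f.boundaryTube.core θ = Φ.core θ := boundaryTube_core_eq_of_incl_core f hΦcore
  set q := ambCurve g f.attachingCircle t with hq_def
  set T := deriv (ambCurve g f.attachingCircle) t with hT_def
  set d := (CircleTube.fibreDeriv f.boundaryTube Φ (circlePt t) planeE0) 0 *
      (CircleTube.fibreDeriv f.boundaryTube Φ (circlePt t) planeE1) 1 -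
    (CircleTube.fibreDeriv f.boundaryTube Φ (circlePt t) planeE0) 1 *
      (CircleTube.fibreDeriv f.boundaryTube Φ (circlePt t) planeE1) 0 with hd
  have hd0 : d ≠ 0 := fibreDeriv_det_ne_zero hcore (circlePt t)
  -- page facts at the core point
  have hKd : MDifferentiableAt (𝓡 1) (𝓡∂ 4) f.attachingCircle (circlePt t) :=
    (isSmoothEmbedding_attachingCircle f).contMDiff.mdifferentiableAt (by simp)
  have hT : dPhiX g q * cx T + dPhiY q * cy T = 0 :=
    dPhi_velocity_eq_zero_of_page hKc (hasDerivAt_ambCurve (g := g) hKd).differentiableAt.hasDerivAt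
  have hw : w g q = c / 2 := (hKc (circlePt t)).2
  have hflat : ‖cx q‖ ^ 2 < 4 := (hKc (circlePt t)).1
  have hq0 : q ≠ 0 := ne_zero_of_w_eq_half hc hw
  have hw0 : w g q ≠ 0 := by
    rw [hw]; intro h0
    have : c = 0 := by linear_combination 2 * h0
    rw [this, norm_zero] at hc; exact zero_ne_one hc
  have hT0 : T ≠ 0 := deriv_ambCurve_ne_zero (isSmoothEmbedding_attachingCircle f) t
  have hP : 0 < det4 (gradient (rho g) q) T (cplxJ T) (horizNormal g q) := det4_pageFrame_pos hq0 hflat hw0 hT0 hT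
  -- `⟪rot, n⟫ > 0`, `⟪n, n⟫ > 0`
  have hρ : rho g q ≤ 3 / 10 := by
    have h1 : rho g q ≤ 1 / 4 := (f.attachingCircle (circlePt t)).2
    linarith
  have hN : 0 < ‖dPhiX g q‖ ^ 2 + ‖dPhiY q‖ ^ 2 := dPhi_normSq_pos (g := g) hq0
  have hRn : 0 < inner ℝ (rotField g q) (horizNormal g q) := by
    rw [inner_rotField_horizNormal hρ]
    exact div_pos (pow_pos (norm_pos_iff.2 hw0) 2) hN
  have hnn : 0 < inner ℝ (horizNormal g q) (horizNormal g q) := by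
    rw [real_inner_self_eq_norm_sq]
    have h1 := norm_horizNormal_sq_of_page (g := g) hc hw
    rcases (sq_nonneg ‖horizNormal g q‖).lt_or_eq with h | h
    · exact h
    · rw [← h, zero_mul] at h1; exact absurd h1 zero_ne_one
  have e : d * (r * κ * d * (inner ℝ (rotField g q) (horizNormal g q) / inner ℝ (horizNormal g q) (horizNormal g q)) *
      det4 (gradient (rho g) q) T (cplxJ T) (horizNormal g q)) =
      (d * d) * r * κ * (inner ℝ (rotField g q) (horizNormal g q) / inner ℝ (horizNormal g q) (horizNormal g q)) *
        det4 (gradient (rho g) q) T (cplxJ T) (horizNormal g q) := by ring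
  rw [e]
  have hdd : 0 < d * d := by nlinarith [sq_pos_of_ne_zero hd0]
  have hγ : 0 < inner ℝ (rotField g q) (horizNormal g q) / inner ℝ (horizNormal g q) (horizNormal g q) :=
    div_pos hRn hnn
  positivity

end Core

/-! ## §3 The registered package -/

/-- **Sub-goal `helper_attachChar_core` of stub `stub_T3_dualPresentation`** (T3 ▸ HB = `helper_Hgap_twisting` ▸
transfer step (R6c), tube side; wave 7, lead c5, worker H2): **the orientation character of the attaching tube
at the core is the frame sign** — for an attaching map `f` with attaching circle `K` in the flat page of
direction `c`, Z4's page tube `Φ` around `K` (clauses `hΦcore`, `hΦder`, `0 < κ`, `0 < r`) and the transition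
matrix `A = CircleTube.fibreDeriv f♭ Φ`: `0 < det A(e^{2πit}) · det4 (∇rho (K t), D e₀, D e₁, K'(t))`, `D` the
fibre derivative of the attaching tube at the core point. [cite: Baykur2006, §2.3] -/
theorem helper_attachChar_core : ∀ (g : ℕ) (f : Literature.Topology.FourManifolds.HandleAttachingMap 3 2 (Literature.Topology.FourManifolds.LefschetzBase.Base g)) (c : ℂ), ‖c‖ = 1 → (∀ θ, f.attachingCircle θ ∈ Literature.Topology.FourManifolds.LefschetzBase.page g c) → ∀ (κ r : ℝ) (Φ : Literature.Topology.FourManifolds.CircleTube (Literature.Topology.FourManifolds.LefschetzBase.bBase g).carrier), 0 < κ → 0 < r → (∀ ψ, (Literature.Topology.FourManifolds.LefschetzBase.bBase g).incl (Φ.core ψ) = f.attachingCircle ψ) → (∀ t : ℝ, HasFDerivAt (fun v : EuclideanSpace ℝ (Fin 2) => ((Literature.Topology.FourManifolds.LefschetzBase.bBase g).incl (Φ.toHomeo (Literature.Topology.FourManifolds.circlePt t, v))).1) ((EuclideanSpace.proj (𝕜 := ℝ) (0 : Fin 2)).smulRight (r • Literature.Topology.FourManifolds.LefschetzBase.cplxJ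 (deriv (Literature.Topology.FourManifolds.LefschetzBase.ambCurve g f.attachingCircle) t)) + (EuclideanSpace.proj (𝕜 := ℝ) (1 : Fin 2)).smulRight (κ • Summit.SmoothPoincare4.SmoothPoincare4.Theorems.AcyclicBisectionExists.ModpBraidOrbits.rotField g (f.attachingCircle (Literature.Topology.FourManifolds.circlePt t)).1)) 0) → ∀ (t : ℝ), 0 < ((Literature.Topology.FourManifolds.CircleTube.fibreDeriv f.boundaryTube Φ (Literature.Topology.FourManifolds.circlePt t) Literature.Topology.FourManifolds.planeE0) 0 * (Literature.Topology.FourManifolds.CircleTube.fibreDeriv f.boundaryTube Φ (Literature.Topology.FourManifolds.circlePt t) Literature.Topology.FourManifolds.planeE1) 1 - (Literature.Topology.FourManifolds.CircleTube.fibreDeriv f.boundaryTube Φ (Literature.Topology.FourManifolds.circlePt t) Literature.Topology.FourManifolds.planeE0) 1 * (Literature.Topology.FourManifolds.CircleTube.fibreDeriv f.boundaryTube Φ (Literature.Topology.FourManifolds.circlePt t) Literature.Topology.FourManifolds.planeE1) 0) * Literature.Geometry.Symplectic.det4 (gradient (Literature.Topology.FourManifolds.LefschetzBase.rho g) (Literature.Topology.FourManifolds.LefschetzBase.ambCurve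 g f.attachingCircle t)) (fderiv ℝ (fun v : EuclideanSpace ℝ (Fin 2) => (f.toFun (Literature.Topology.FourManifolds.depthLine (Literature.Topology.FourManifolds.circlePt t) v 0)).1) 0 Literature.Topology.FourManifolds.planeE0) (fderiv ℝ (fun v : EuclideanSpace ℝ (Fin 2) => (f.toFun (Literature.Topology.FourManifolds.depthLine (Literature.Topology.FourManifolds.circlePt t) v 0)).1) 0 Literature.Topology.FourManifolds.planeE1) (deriv (Literature.Topology.FourManifolds.LefschetzBase.ambCurve g f.attachingCircle) t) :=
  fun _ f _ hc hKc _ _ _ hκ hr hΦcore hΦder t => det4_fibreDeriv_core_pos f hc hKc hΦcore hΦder hκ hr t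

end Summit.SmoothPoincare4.SmoothPoincare4.Theorems.AcyclicBisectionExists.ModpBraidOrbits

end
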